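import Summits.Ventures.Crystal3D.Theorems.StickyWulffConstantPolycrystalWulffBoundNearTwinReductionSharp

/-!
# `PolycrystalWulffBound`, lane P: the near-twin reduction about the frame's OWN basal axis —
# a statement on frames only (helper for crux `stmt-Ventures-19482`; poly-p2 g22; memo NEARTWIN-KERNEL-g22)

Route `StickyWulffConstant` of the venture `Summits/Ventures/Crystal3D`, second prover lane.  The
operator-norm form of the near-twin reduction (`nearTwinFrames_of_twoGrainTwinInequality_sharp`,
`…NearTwinReductionSharp`) still carries the crux clause `Ax m₀ A A` («`m₀` is a stacking axis of the
lattice `A·Λ`»).  For the frame's own basal axis `m₀ = A e₃` that clause is automatic — the reference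
lattice `Λ = fccStacking 1 √(2/3)` IS the Barlow stacking of the constant Hägg sequence along `e₃`
(`fccStacking = barlowStacking … constHagg` by definition, `isHaggSeq_const`) — so the reduction becomes a
statement about FRAMES ONLY:

* `cruxAx_basal_self` — `Ax (A e₃) A A` for every crux frame `A` (frame `L = A`, shifts `0`, words
  `constHagg`);
* `nearTwinBasal_of_twoGrainTwinInequality_sharp` — `TwoGrainTwinInequality →` for every `c ≥ 1`, every
  `δ` with `2(2√5 − 1)·√5·δ ≤ √3(2 − 2^{2/3})` (`δ ≤ 0.0460`), all frames `A, B` with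
  `‖B x − R_{A e₃}(A x)‖ ≤ δ‖x‖` for all `x` (every `B` within `2.64°` of the BASAL TWIN FRAME
  `R_{A e₃} ∘ A` of `A`), and every disjoint polyhedral pair `S₁, S₂` of finite volume, the conclusion of
  `GenericTwoGrainInequality c` holds for `(A, B)`.
Every twin of the crux is a basal twin of an equivalent frame: the other three `{111}` twins of `A` are
the basal twins of `A ∘ g` for a lattice symmetry `g` (`(A ∘ g)·Λ = A·Λ`, hence `W(A ∘ g) = W(A)` by
`wulffBody_eq_of_image_eq`), so this form loses nothing for the certified column.
WHAT THIS IS NOT: a proof of the named fact; the crux is not claimed; rung F-C1 not moved.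
-/

noncomputable section

open scoped BigOperators InnerProductSpace ENNReal Pointwise
open MeasureTheory Filter Set Metric

namespace Summit.Ventures.Crystal3D.Cruxes.PolycrystalWulffBound.PolyDensity

open Summit.Ventures.Crystal3D.Theorems
open Summit.Ventures.Crystal3D.Cruxes.TextureLiminf.TexShadow (per polytope supportFn E3)
open Literature.MathematicalPhysics.StatisticalMechanics (fccStacking barlowStacking IsHaggSeq constHagg
  isHaggSeq_const)

/-- **Every crux frame is co-axial with itself about its own basal axis**: `Ax (A e₃) A A`, spelled out
(frame `L = A`, shifts `0`, both words the constant Hägg sequence — `fccStacking 1 √(2/3)` is by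
definition `barlowStacking 1 √(2/3) constHagg`). -/
theorem cruxAx_basal_self (A : EuclideanSpace ℝ (Fin 3) ≃ₗᵢ[ℝ] EuclideanSpace ℝ (Fin 3)) :
    ∃ (L : EuclideanSpace ℝ (Fin 3) ≃ₗᵢ[ℝ] EuclideanSpace ℝ (Fin 3)) (s₁ s₂ : EuclideanSpace ℝ (Fin 3))
      (σ σ' : ℤ → ℤ), IsHaggSeq σ ∧ IsHaggSeq σ' ∧
      L (EuclideanSpace.single (2 : Fin 3) (1 : ℝ)) = A (EuclideanSpace.single (2 : Fin 3) (1 : ℝ)) ∧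
      A '' fccStacking 1 (Real.sqrt (2 / 3)) ⊆
        (fun q => L q + s₁) '' barlowStacking 1 (Real.sqrt (2 / 3)) σ ∧
      A '' fccStacking 1 (Real.sqrt (2 / 3)) ⊆
        (fun q => L q + s₂) '' barlowStacking 1 (Real.sqrt (2 / 3)) σ' := by
  refine ⟨A, 0, 0, constHagg, constHagg, isHaggSeq_const, isHaggSeq_const, rfl, ?_, ?_⟩
  all_goals
    rintro _ ⟨p, hp, rfl⟩
    exact ⟨p, hp, by simp⟩

/-- **Near-twin reduction about the basal axis, frames only, SHARP threshold** (`TwoGrainTwinInequality`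
by name): see the module docstring.  Proof: `nearTwinFrames_of_twoGrainTwinInequality_sharp` with
`m₀ = A e₃` and `cruxAx_basal_self`. -/
theorem nearTwinBasal_of_twoGrainTwinInequality_sharp (hTG : TwoGrainTwinInequality) {c δ : ℝ}
    (hc : 1 ≤ c)
    (hδ : 2 * (2 * Real.sqrt 5 - 1) * (Real.sqrt 5 * δ) ≤ Real.sqrt 3 * (2 - (2 : ℝ) ^ ((2 : ℝ) / 3))) :
    let Λ : Set (EuclideanSpace ℝ (Fin 3)) := Literature.MathematicalPhysics.StatisticalMechanics.fccStacking 1 (Real.sqrt (2 / 3));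
    let Φ : EuclideanSpace ℝ (Fin 3) → ℝ := fun ν => Real.sqrt 2 / 4 * ∑ᶠ w ∈ {w ∈ Λ | ‖w‖ = 1}, |⟪w, ν⟫_ℝ|;
    let Per : Set (EuclideanSpace ℝ (Fin 3)) → Set (EuclideanSpace ℝ (Fin 3)) → ℝ := fun K S => (⨆ (ξ : EuclideanSpace ℝ (Fin 3) → EuclideanSpace ℝ (Fin 3)) (_ : ContDiff ℝ 1 ξ ∧ HasCompactSupport ξ ∧ ∀ z, ξ z ∈ K), ENNReal.ofReal (∫ z in S, Literature.MathematicalPhysics.StatisticalMechanics.fieldDivergence ξ z)).toReal;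
    let ι : Set (EuclideanSpace ℝ (Fin 3)) → Set (EuclideanSpace ℝ (Fin 3)) → Set (EuclideanSpace ℝ (Fin 3)) → ℝ := fun K S₁ S₂ => (Per K S₁ + Per K S₂ - Per K (S₁ ∪ S₂)) / 2;
    let W : (EuclideanSpace ℝ (Fin 3) ≃ₗᵢ[ℝ] EuclideanSpace ℝ (Fin 3)) → Set (EuclideanSpace ℝ (Fin 3)) := fun A => {y | ∀ ν : EuclideanSpace ℝ (Fin 3), ⟪y, ν⟫_ℝ ≤ Φ (A.symm ν)};
    let Dsc : EuclideanSpace ℝ (Fin 3) → Set (EuclideanSpace ℝ (Fin 3)) := fun m => {y | ‖y‖ ≤ 1 ∧ ⟪y, m⟫_ℝ = 0};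
    let Poly : Set (EuclideanSpace ℝ (Fin 3)) → Prop := fun S => ∃ (k : ℕ) (H : Fin k → Finset ((EuclideanSpace ℝ (Fin 3)) × ℝ)), S = ⋃ i, ⋂ p ∈ H i, {x | ⟪p.1, x⟫_ℝ < p.2};
    ∀ (A B : EuclideanSpace ℝ (Fin 3) ≃ₗᵢ[ℝ] EuclideanSpace ℝ (Fin 3)),
      (∀ x : EuclideanSpace ℝ (Fin 3),
        ‖B x - (ℝ ∙ A (EuclideanSpace.single (2 : Fin 3) (1 : ℝ)))ᗮ.reflection (A x)‖ ≤ δ * ‖x‖) →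
      ∀ S₁ S₂ : Set (EuclideanSpace ℝ (Fin 3)), Poly S₁ → Poly S₂ → volume S₁ < ⊤ → volume S₂ < ⊤ → Disjoint S₁ S₂ →
        6 * (2 : ℝ) ^ ((1 : ℝ) / 3) * (Real.sqrt 2 * (volume (S₁ ∪ S₂)).toReal) ^ ((2 : ℝ) / 3) ≤
          (Per (W A) S₁ - ι (W A) S₁ S₂) + (Per (W B) S₂ - ι (W B) S₂ S₁) + c * ι (Dsc 0) S₁ S₂ := by
  intro Λ Φ Per ι W Dsc Poly A B hnear S₁ S₂ hP₁ hP₂ hv₁ hv₂ hd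
  exact nearTwinFrames_of_twoGrainTwinInequality_sharp hTG hc hδ A B
    (A (EuclideanSpace.single (2 : Fin 3) (1 : ℝ))) (cruxAx_basal_self A) hnear S₁ S₂ hP₁ hP₂ hv₁ hv₂ hd

end Summit.Ventures.Crystal3D.Cruxes.PolycrystalWulffBound.PolyDensity

end
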